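import Summits.Ventures.LatticeQCDFlow.Scoring.SUNOnePlaquetteHaarMGF
import Summits.Ventures.LatticeQCDFlow.Scoring.UNOnePlaquettePlaquetteBessel
import Literature.Analysis.Convex.NonnegCoeffPowerSeriesConvex
import Mathlib.Analysis.Calculus.SmoothSeries
import HarnessLib

/-!
# The `SU(N)` one-plaquette PLAQUETTE in Bessel form for every `N`: term-wise differentiation of `Σ_q det[I_{|q+i−j|}(x)]`

HONEST FRAMING: exact (Metropolis-corrected) sampling algorithms for lattice gauge theory;
figures of merit are autocorrelation/cost numbers at stated couplings and volumes; no
continuum-physics claim.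

Venture `LatticeQCDFlow` (cell pub-lqcd), sub-topic `Scoring`; FANOUT row 5 (`s0-sun-a`), GEN-17.
NEW WORK of the cell (placement rule).  `SUNOnePlaquetteBesselSeries` gave the `SU(N)` one-plaquette integral
`∫_{SU(N)} e^{x Re tr U} dU = Σ_{q ∈ ℤ} D_q(x)`, `D_q(x) = det[I_{|q+i−j|}(x)]_{i,j<N}`, and `SUNOnePlaquetteHaarMGF`
the plaquette as `(1/N)(log Σ_q D_q)'`.  Here the derivative of the series is computed TERM BY TERM, giving
the explicit oracle formula for every `N` (GEN-16's `OnePlaquetteSU3PlaquetteBessel` is `N = 3`):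

* §1 a Leibniz-type bound `|det A| ≤ C^{N−1} Σ_σ |A_{σ(l), l}|` for a matrix with entries bounded by `C`, and
  the entry bound `|I_{|m|}(y)| ≤ I_{|m|}(R) ≤ e^R` for `|y| ≤ R`;
* §2 `d/dx D_q(x) = ½ Σ_l (det D^{−}_{q,l}(x) + det D^{+}_{q,l}(x))`, `D^{∓}_{q,l}` = `D_q` with column `l` replaced by
  `(I_{|q+i−l∓1|}(x))_i` (Jacobi's formula of `UNOnePlaquettePlaquetteBessel` and `I_{|m|}' = (I_{|m−1|}+I_{|m+1|})/2`);
* §3 the summable majorant `|d/dy D^{(∓)}_{q,l}(y)| ≤ e^{R(N−1)} Σ_σ I_{|q+σ(l)−l∓1|}(R)` on `|y| ≤ R` and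
  **`d/dx Σ_q D_q(x) = Σ_q ½ Σ_l (det D^{−}_{q,l}(x) + det D^{+}_{q,l}(x))`** (`hasDerivAt_tsum_of_isPreconnected`);
* §4 **`⟨(1/N) Re tr U_p⟩_β^{SU(N)} = Σ_q Σ_l (det D^{−}_{q,l}(β) + det D^{+}_{q,l}(β)) / (2N Σ_q D_q(β))`**, every `N ≥ 1`.

No `def`, nothing cited as a fact, 0 sorry.
-/

noncomputable section

open Real MeasureTheory Filter Topology Finset Complex Set
open scoped ENNReal
open ProbabilityTheory
open Literature.MathematicalPhysics.QuantumFieldTheory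
open Literature.MathematicalPhysics.QuantumLattice
open Literature.Analysis.FunctionSpaces
open Literature.Analysis.Convex

namespace Summit.Ventures.LatticeQCDFlow.Scoring

/-! ### 1. Entry and determinant bounds -/

/-- **Leibniz bound along a column**: if every entry of `A` is bounded by `C ≥ 0` in absolute value then, for
any column `l`, `|det A| ≤ C^{card ι − 1} Σ_σ |A_{σ(l), l}|`. -/
theorem abs_det_le_pow_mul_sum {ι : Type*} [Fintype ι] [DecidableEq ι] (A : Matrix ι ι ℝ) {C : ℝ}
    (hC : ∀ i j, |A i j| ≤ C) (l : ι) :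
    |A.det| ≤ C ^ (Fintype.card ι - 1) * ∑ σ : Equiv.Perm ι, |A (σ l) l| := by
  rw [Matrix.det_apply', Finset.mul_sum]
  refine (Finset.abs_sum_le_sum_abs _ _).trans (Finset.sum_le_sum fun σ _ => ?_)
  have hsgn : |((Equiv.Perm.sign σ : ℤ) : ℝ)| = 1 := by
    rcases Int.units_eq_one_or (Equiv.Perm.sign σ) with h | h <;> simp [h]
  rw [abs_mul, hsgn, one_mul, ← Finset.mul_prod_erase Finset.univ (fun i => A (σ i) i) (Finset.mem_univ l),
    abs_mul, Finset.abs_prod]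
  calc |A (σ l) l| * ∏ j ∈ Finset.univ.erase l, |A (σ j) j|
      ≤ |A (σ l) l| * C ^ (Fintype.card ι - 1) := by
        refine mul_le_mul_of_nonneg_left ?_ (abs_nonneg _)
        calc ∏ j ∈ Finset.univ.erase l, |A (σ j) j| ≤ ∏ j ∈ Finset.univ.erase l, C :=
              Finset.prod_le_prod (fun j _ => abs_nonneg _) fun j _ => hC _ _
          _ = C ^ (Fintype.card ι - 1) := by
              rw [Finset.prod_const, Finset.card_erase_of_mem (Finset.mem_univ l), Finset.card_univ]
    _ = C ^ (Fintype.card ι - 1) * |A (σ l) l| := mul_comm _ _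

/-- `|I_{|m|}(y)| ≤ I_{|m|}(R)` for `|y| ≤ R` (`I_n` is even/odd and non-decreasing on `[0, ∞)`). -/
theorem abs_besselI_natAbs_le_of_abs_le {y R : ℝ} (hR : |y| ≤ R) (m : ℤ) : |besselI m.natAbs y| ≤ besselI m.natAbs R := by
  rw [abs_besselI_eq_besselI_abs]
  exact monotoneOn_besselI _ (abs_nonneg y) ((abs_nonneg y).trans hR) hR

/-- `I_{|m|}(R) ≤ e^R` for `R ≥ 0` (one term of `Σ_m I_{|m|}(R) = e^R`). -/
theorem besselI_natAbs_le_exp {R : ℝ} (hR : 0 ≤ R) (m : ℤ) : besselI m.natAbs R ≤ Real.exp R :=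
  le_hasSum (hasSum_besselI_natAbs R) m fun _ _ => besselI_nonneg _ hR

/-- **The determinant bound for a Bessel-entry matrix**: if `A_{ij} = I_{|w(i,j)|}(y)` with `|y| ≤ R`, then for any
column `l`, `|det A| ≤ e^{R(N−1)} Σ_σ I_{|w(σ(l), l)|}(R)`. -/
theorem abs_det_besselI_entry_le {N : ℕ} (w : Fin N → Fin N → ℤ) {y R : ℝ} (hR : |y| ≤ R) (l : Fin N) :
    |(Matrix.of fun i j : Fin N => besselI (w i j).natAbs y).det|
      ≤ Real.exp R ^ (N - 1) * ∑ σ : Equiv.Perm (Fin N), besselI (w (σ l) l).natAbs R := by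
  have hR0 : 0 ≤ R := (abs_nonneg y).trans hR
  have h := abs_det_le_pow_mul_sum (Matrix.of fun i j : Fin N => besselI (w i j).natAbs y)
    (C := Real.exp R) (fun i j => (abs_besselI_natAbs_le_of_abs_le hR _).trans (besselI_natAbs_le_exp hR0 _)) l
  rw [Fintype.card_fin] at h
  refine h.trans (mul_le_mul_of_nonneg_left (Finset.sum_le_sum fun σ _ => ?_) (pow_nonneg (Real.exp_pos R).le _))
  exact abs_besselI_natAbs_le_of_abs_le hR _

/-- A column replacement inside a Bessel-entry matrix is again a Bessel-entry matrix. -/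
theorem updateCol_of_besselI {N : ℕ} (w : Fin N → Fin N → ℤ) (v : Fin N → ℤ) (l : Fin N) (y : ℝ) :
    (Matrix.of fun i j : Fin N => besselI (w i j).natAbs y).updateCol l (fun i => besselI (v i).natAbs y)
      = Matrix.of fun i j : Fin N => besselI (if j = l then v i else w i j).natAbs y := by
  ext i j
  rw [Matrix.updateCol_apply, Matrix.of_apply, Matrix.of_apply]
  split_ifs <;> rfl

/-! ### 2. `d/dx D_q(x)` column by column -/

/-- **`d/dx det[I_{|q+i−j|}(x)] = ½ Σ_l (det D^{−}_{q,l}(x) + det D^{+}_{q,l}(x))`**, `D^{∓}_{q,l}` = the matrix with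
column `l` replaced by `(I_{|q+i−l−1|}(x))_i`, resp. `(I_{|q+i−l+1|}(x))_i`. -/
theorem hasDerivAt_det_besselI_shift_columns (N : ℕ) (q : ℤ) (x : ℝ) :
    HasDerivAt (fun y : ℝ => (Matrix.of fun i j : Fin N => besselI (q + (i : ℤ) - (j : ℤ)).natAbs y).det)
      ((1 / 2 : ℝ) * ∑ l : Fin N,
        (((Matrix.of fun i j : Fin N => besselI (q + (i : ℤ) - (j : ℤ)).natAbs x).updateCol l
            fun i => besselI (q + (i : ℤ) - (l : ℤ) - 1).natAbs x).det
          + ((Matrix.of fun i j : Fin N => besselI (q + (i : ℤ) - (j : ℤ)).natAbs x).updateCol l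
            fun i => besselI (q + (i : ℤ) - (l : ℤ) + 1).natAbs x).det)) x := by
  have h := hasDerivAt_matrix_det (ι := Fin N)
    (M := fun y => Matrix.of fun i j : Fin N => besselI (q + (i : ℤ) - (j : ℤ)).natAbs y)
    (M' := Matrix.of fun i j : Fin N =>
      (besselI (q + (i : ℤ) - (j : ℤ) - 1).natAbs x + besselI (q + (i : ℤ) - (j : ℤ) + 1).natAbs x) / 2)
    (x := x) (fun i j => by simpa [Matrix.of_apply] using hasDerivAt_besselI_natAbs (q + (i : ℤ) - (j : ℤ)) x)
  refine h.congr_deriv ?_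
  rw [Finset.mul_sum]
  refine Finset.sum_congr rfl fun l _ => ?_
  simp only [Matrix.of_apply]
  rw [show (fun i : Fin N =>
        (besselI (q + (i : ℤ) - (l : ℤ) - 1).natAbs x + besselI (q + (i : ℤ) - (l : ℤ) + 1).natAbs x) / 2)
      = (1 / 2 : ℝ) • ((fun i : Fin N => besselI (q + (i : ℤ) - (l : ℤ) - 1).natAbs x)
          + fun i : Fin N => besselI (q + (i : ℤ) - (l : ℤ) + 1).natAbs x) from by
        funext i; simp only [Pi.smul_apply, Pi.add_apply, smul_eq_mul]; ring,
    Matrix.det_updateCol_smul, Matrix.det_updateCol_add]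

/-! ### 3. The summable majorant and the term-wise derivative -/

/-- `Σ_q I_{|q+c|}(R) < ∞` (a shift of `Σ_m I_{|m|}(R) = e^R`). -/
theorem summable_besselI_natAbs_add (R : ℝ) (c : ℤ) : Summable fun q : ℤ => besselI (q + c).natAbs R :=
  ((Equiv.addRight c).summable_iff.2 (summable_besselI_natAbs R)).congr fun _ => rfl

/-- **The majorant**: for `|y| ≤ R`, the column-replaced determinant is bounded by
`e^{R(N−1)} Σ_σ I_{|q+σ(l)−l+c|}(R)`, summable in `q`. -/
theorem abs_det_updateCol_besselI_le (N : ℕ) (q c : ℤ) {y R : ℝ} (hR : |y| ≤ R) (l : Fin N) :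
    |(((Matrix.of fun i j : Fin N => besselI (q + (i : ℤ) - (j : ℤ)).natAbs y).updateCol l
        fun i => besselI (q + (i : ℤ) - (l : ℤ) + c).natAbs y).det)|
      ≤ Real.exp R ^ (N - 1) * ∑ σ : Equiv.Perm (Fin N), besselI (q + ((σ l : Fin N) : ℤ) - (l : ℤ) + c).natAbs R := by
  rw [updateCol_of_besselI]
  refine (abs_det_besselI_entry_le _ hR l).trans (le_of_eq ?_)
  simp only [if_true]

/-- `Σ_q D_q(y)` converges (absolutely) for every `y`. -/
theorem summable_det_besselI_shift (N : ℕ) [NeZero N] (y : ℝ) :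
    Summable fun q : ℤ => (Matrix.of fun i j : Fin N => besselI (q + (i : ℤ) - (j : ℤ)).natAbs y).det := by
  have hg : Summable fun q : ℤ => Real.exp |y| ^ (N - 1) *
      ∑ σ : Equiv.Perm (Fin N), besselI (q + ((σ 0 : Fin N) : ℤ) - ((0 : Fin N) : ℤ)).natAbs |y| := by
    refine Summable.mul_left _ (summable_sum fun σ _ => ?_)
    exact (summable_besselI_natAbs_add |y| (((σ 0 : Fin N) : ℤ) - ((0 : Fin N) : ℤ))).congr fun q => by
      congr 2; ring
  refine Summable.of_norm_bounded hg fun q => ?_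
  rw [Real.norm_eq_abs]
  exact abs_det_besselI_entry_le (fun i j : Fin N => q + (i : ℤ) - (j : ℤ)) le_rfl 0

/-- **THE TERM-WISE DERIVATIVE OF THE `SU(N)` BESSEL SERIES**:
`d/dx Σ_q det[I_{|q+i−j|}(x)] = Σ_q ½ Σ_l (det D^{−}_{q,l}(x) + det D^{+}_{q,l}(x))`. -/
theorem hasDerivAt_tsum_det_besselI_shift (N : ℕ) [NeZero N] (x : ℝ) :
    HasDerivAt (fun y : ℝ => ∑' q : ℤ, (Matrix.of fun i j : Fin N => besselI (q + (i : ℤ) - (j : ℤ)).natAbs y).det)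
      (∑' q : ℤ, (1 / 2 : ℝ) * ∑ l : Fin N,
        ((((Matrix.of fun i j : Fin N => besselI (q + (i : ℤ) - (j : ℤ)).natAbs x).updateCol l
            fun i => besselI (q + (i : ℤ) - (l : ℤ) - 1).natAbs x).det
          + ((Matrix.of fun i j : Fin N => besselI (q + (i : ℤ) - (j : ℤ)).natAbs x).updateCol l
            fun i => besselI (q + (i : ℤ) - (l : ℤ) + 1).natAbs x).det))) x := by
  set R : ℝ := |x| + 1 with hRdef
  have hball : ∀ y ∈ Metric.ball x 1, |y| ≤ R := fun y hy => by
    have h := Metric.mem_ball.1 hy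
    rw [Real.dist_eq] at h
    linarith [abs_sub_abs_le_abs_sub y x]
  -- the majorant
  set u : ℤ → ℝ := fun q => (1 / 2 : ℝ) * ∑ l : Fin N,
    (Real.exp R ^ (N - 1) * ∑ σ : Equiv.Perm (Fin N), besselI (q + ((σ l : Fin N) : ℤ) - (l : ℤ) + (-1)).natAbs R
      + Real.exp R ^ (N - 1) * ∑ σ : Equiv.Perm (Fin N), besselI (q + ((σ l : Fin N) : ℤ) - (l : ℤ) + 1).natAbs R)
    with hudef
  have hu : Summable u := by
    refine Summable.mul_left _ (summable_sum fun l _ => Summable.add ?_ ?_) <;>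
      refine Summable.mul_left _ (summable_sum fun σ _ => ?_)
    · exact (summable_besselI_natAbs_add R (((σ l : Fin N) : ℤ) - (l : ℤ) + (-1))).congr fun q => by
        congr 2; ring
    · exact (summable_besselI_natAbs_add R (((σ l : Fin N) : ℤ) - (l : ℤ) + 1)).congr fun q => by
        congr 2; ring
  have hmain := hasDerivAt_tsum_of_isPreconnected
    (g := fun (q : ℤ) (y : ℝ) => (Matrix.of fun i j : Fin N => besselI (q + (i : ℤ) - (j : ℤ)).natAbs y).det)
    (g' := fun (q : ℤ) (y : ℝ) => (1 / 2 : ℝ) * ∑ l : Fin N,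
        ((((Matrix.of fun i j : Fin N => besselI (q + (i : ℤ) - (j : ℤ)).natAbs y).updateCol l
            fun i => besselI (q + (i : ℤ) - (l : ℤ) - 1).natAbs y).det
          + ((Matrix.of fun i j : Fin N => besselI (q + (i : ℤ) - (j : ℤ)).natAbs y).updateCol l
            fun i => besselI (q + (i : ℤ) - (l : ℤ) + 1).natAbs y).det)))
    (t := Metric.ball x 1) (y₀ := x) (y := x) hu Metric.isOpen_ball (convex_ball x 1).isPreconnected
    (fun q y _ => hasDerivAt_det_besselI_shift_columns N q y) ?_ (Metric.mem_ball_self zero_lt_one)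
    (summable_det_besselI_shift N x) (Metric.mem_ball_self zero_lt_one)
  · exact hmain
  -- the bound `‖g' q y‖ ≤ u q` on the ball
  intro q y hy
  have hyR := hball y hy
  rw [Real.norm_eq_abs, abs_mul, abs_of_pos (by norm_num : (0 : ℝ) < 1 / 2), hudef]
  refine mul_le_mul_of_nonneg_left ((Finset.abs_sum_le_sum_abs _ _).trans
    (Finset.sum_le_sum fun l _ => (abs_add_le _ _).trans (add_le_add ?_ ?_))) (by norm_num)
  · have h := abs_det_updateCol_besselI_le N q (-1) hyR l
    simp only [← sub_eq_add_neg] at h ⊢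
    exact h
  · exact abs_det_updateCol_besselI_le N q 1 hyR l

/-! ### 4. The `SU(N)` plaquette in Bessel form -/

/-- **THE `SU(N)` ONE-PLAQUETTE PLAQUETTE IN BESSEL FORM, EVERY `N ≥ 1`**:
`∫ (1/N) Re tr U e^{−β(N − Re tr U)} dU / ∫ e^{−β(N − Re tr U)} dU`
`= Σ_q Σ_l (det D^{−}_{q,l}(β) + det D^{+}_{q,l}(β)) / (2N Σ_q det[I_{|q+i−j|}(β)])` on `SU(N)` Haar. -/
theorem specialUnitary_plaquette_eq_bessel (N : ℕ) [NeZero N] (β : ℝ) :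
    (∫ u, ((u : Matrix.specialUnitaryGroup (Fin N) ℂ) : Matrix (Fin N) (Fin N) ℂ).trace.re / N *
          Real.exp (-(β * ((N : ℝ) - ((u : Matrix.specialUnitaryGroup (Fin N) ℂ) : Matrix (Fin N) (Fin N) ℂ).trace.re)))
        ∂(haarProbability (Matrix.specialUnitaryGroup (Fin N) ℂ)))
      / (∫ u, Real.exp (-(β * ((N : ℝ) - ((u : Matrix.specialUnitaryGroup (Fin N) ℂ) :
          Matrix (Fin N) (Fin N) ℂ).trace.re))) ∂(haarProbability (Matrix.specialUnitaryGroup (Fin N) ℂ)))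
      = (∑' q : ℤ, ∑ l : Fin N,
          ((((Matrix.of fun i j : Fin N => besselI (q + (i : ℤ) - (j : ℤ)).natAbs β).updateCol l
              fun i => besselI (q + (i : ℤ) - (l : ℤ) - 1).natAbs β).det
            + ((Matrix.of fun i j : Fin N => besselI (q + (i : ℤ) - (j : ℤ)).natAbs β).updateCol l
              fun i => besselI (q + (i : ℤ) - (l : ℤ) + 1).natAbs β).det)))
        / (2 * N * ∑' q : ℤ, (Matrix.of fun i j : Fin N => besselI (q + (i : ℤ) - (j : ℤ)).natAbs β).det) := by
  rw [specialUnitary_plaquette_eq_deriv_log_tsum_det]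
  have hpos : 0 < ∑' q : ℤ, (Matrix.of fun i j : Fin N => besselI (q + (i : ℤ) - (j : ℤ)).natAbs β).det := by
    rw [← integral_haar_specialUnitaryGroup_fin_exp_mul_trace_re]
    exact integral_exp_pos (integrable_exp_mul_of_abs_le_const
      (aestronglyMeasurable_trace_re_specialUnitaryGroup N) (fun u => abs_trace_re_le_card_su u) β)
  rw [((hasDerivAt_tsum_det_besselI_shift N β).log hpos.ne').deriv, tsum_mul_left]
  have hN : (N : ℝ) ≠ 0 := Nat.cast_ne_zero.2 (NeZero.ne N)
  field_simp

end Summit.Ventures.LatticeQCDFlow.Scoring
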